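import Summits.BirchSwinnertonDyer.BirchSwinnertonDyer.Theorems.GenusKolyvaginAtTwoPowDvdShaCardAtTwoRTLadderCountTwin
import Mathlib.GroupTheory.QuotientGroup.Basic
import Mathlib.GroupTheory.Index
import HarnessLib

/-!
# Route `GenusKolyvaginAtTwo`, LINE 18 v5 (L_T `PowDvdShaCardAtTwoRT`, stmt-BirchSwinnertonDyer-23242) — THE HONEST TWO-SIDED
# COUNT OVER `K`: eigen-ladders of an involution exhibit `p^{2M₀}` only in `#A · #H¹(C₂, A)`

Seat `bsd-line-gk2-p3` g20 (cell `bsd-f1-sign2`), `--supports stmt-BirchSwinnertonDyer-23242` (helper; closes nothing).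
THEOREMS ONLY (no definition, no named fact, no `sorry`), pure group theory over Mathlib + the seat's abstract ladder count
`…RTLadderCountTwin`; BSD is not proved by any of this.

WHY (memo `Cruxes/PowDvdShaCardAtTwoRT/Lines/plus-descent-stubJ-audit.md` §4).  Stub J `stub_jointGenusCountAtTwo` of skeleton v5
(the «cross-side count» `2M₀ ≤ ord₂ g + ord₂ g′ + B` from the two ℚ-side ladders of stub L) is false as typed: existence-only
ladders double-count Kramer's genus classes.  Read over `K`, the two ladders are independent families in the `τ = +1` and
`τ = −1` parts of `A = Ш(E_K/K)[2^∞]` (`τ` = complex conjugation), and at `p = 2` these parts OVERLAP (`A^+ ∩ A^- = A^+[2]`).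
This file is the exact bookkeeping of that overlap, for any finite abelian group `A` with an involution `τ`:
* §1 `range_sub_le_ker_add` (`(τ − 1)A ≤ A^{τ=−1}`), `natCard_ker_mul_natCard_range` (`#ker f · #im f = #A`),
  **`natCard_ker_sub_mul_natCard_ker_add`**: `#A^{τ=+1} · #A^{τ=−1} = #A · #H¹(C₂, A)`, `H¹(C₂, A) = A^{τ=−1}/(τ−1)A`
  (for ODD `#A` the last factor is `1` and this is the eigenspace decomposition `A = A^+ ⊕ A^-`; at `2` it is the defect).
* §2 **`pow_two_mul_sum_dvd_natCard_mul_natCard_h1_of_eigenLadders`**: if for every `m < T` there are `2m+2` independent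
  `τ`-FIXED elements of order `p^{a(2m)}` and `2m+2` independent `τ`-ANTI-FIXED elements of order `p^{a(2m+1)}` in `A`, then
  `p^{2 Σ_{j<2T} a j} ∣ #A · #H¹(C₂, A)` (the abstract twin count `pow_two_mul_sum_dvd_natCard_mul_of_twinLadder` in the two
  eigen-subgroups, then §1); ladder form `pow_two_mul_dvd_…_of_antitone` with `Σ_{j<2T} (M j − M (j+1)) = M 0`.
So a K-side «joint count» J_K is TRUE with the loss term `ord_p #H¹(C₂, Ш(E_K)[p^∞])` and NO sharper antecedent-free count
exists (memo §4: on the two-sided genus rows `A = (ℤ/2)²`, `τ = 1`, `H¹(C₂, A) = A`, and the fake ladder attains the bound).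
What Kolyvagin's argument supplies at odd `p` for free (`H¹(C₂, A) = 0`) is at `p = 2` precisely the content still owed.

References: [McCallumLMS1991] §5 Thm. 5.4 (eigenspace count, `p` odd); [Kramer1981] §4 (13) (genus classes);
[Brown, Cohomology of Groups, III.1 / VI.9] (cohomology of cyclic groups: `H¹(C₂, A) = ker(1+τ)/im(τ−1)`).
-/

set_option autoImplicit false
-- the Theorems namespace of this sub repeats the summit name by design (D-0017 nested layout)
set_option linter.dupNamespace false

universe u

namespace Summit.BirchSwinnertonDyer.BirchSwinnertonDyer.Theorems.GenusExact.PlusDescent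

/-! ## §1 The `C₂`-module identity `#A^+ · #A^- = #A · #H¹(C₂, A)` -/

section Involution

variable {A : Type u} [AddCommGroup A] (τ : A →+ A)

/-- `(τ − 1)A ≤ ker(τ + 1)` for an involution `τ` (`(τ+1)(τ−1) = τ² − 1 = 0`). [folklore] -/
theorem range_sub_le_ker_add (hτ : ∀ a, τ (τ a) = a) :
    (τ - AddMonoidHom.id A).range ≤ (τ + AddMonoidHom.id A).ker := by
  rintro _ ⟨a, rfl⟩
  rw [AddMonoidHom.mem_ker, AddMonoidHom.add_apply, AddMonoidHom.sub_apply, AddMonoidHom.id_apply,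
    AddMonoidHom.id_apply, map_sub, hτ]
  abel

/-- `#ker f · #im f = #A` for an endomorphism of a finite abelian group (first isomorphism theorem + Lagrange). [folklore] -/
theorem natCard_ker_mul_natCard_range [Finite A] (f : A →+ A) :
    Nat.card f.ker * Nat.card f.range = Nat.card A := by
  rw [← Nat.card_congr (QuotientAddGroup.quotientKerEquivRange f).toEquiv, mul_comm]
  exact (AddSubgroup.card_eq_card_quotient_mul_card_addSubgroup f.ker).symm

/-- **`#A^{τ=+1} · #A^{τ=−1} = #A · #H¹(C₂, A)`** for a finite abelian group `A` with an involution `τ`, where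
`A^{τ=±1} = ker(τ ∓ 1)` and `H¹(C₂, A) = ker(τ+1)/(τ−1)A` (cohomology of the cyclic group `⟨τ⟩`): `#A = #ker(τ−1) · #(τ−1)A`
and `#ker(τ+1) = #(τ−1)A · #(ker(τ+1)/(τ−1)A)`.  For `#A` odd the quotient is trivial (eigenspace decomposition); for
`2`-groups it is the overlap defect of the `±`-parts. [folklore] [cite: McCallumLMS1991, §5 Thm. 5.4] -/
theorem natCard_ker_sub_mul_natCard_ker_add [Finite A] (hτ : ∀ a, τ (τ a) = a) :
    Nat.card (τ - AddMonoidHom.id A).ker * Nat.card (τ + AddMonoidHom.id A).ker =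
      Nat.card A * Nat.card ((τ + AddMonoidHom.id A).ker ⧸
        ((τ - AddMonoidHom.id A).range).addSubgroupOf (τ + AddMonoidHom.id A).ker) := by
  have h1 := natCard_ker_mul_natCard_range (τ - AddMonoidHom.id A)
  have h2 : Nat.card (τ + AddMonoidHom.id A).ker =
      Nat.card ((τ + AddMonoidHom.id A).ker ⧸
          ((τ - AddMonoidHom.id A).range).addSubgroupOf (τ + AddMonoidHom.id A).ker) *
        Nat.card (τ - AddMonoidHom.id A).range := by
    rw [AddSubgroup.card_eq_card_quotient_mul_card_addSubgroup
      (((τ - AddMonoidHom.id A).range).addSubgroupOf (τ + AddMonoidHom.id A).ker)]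
    congr 1
    exact Nat.card_congr (AddSubgroup.addSubgroupOfEquivOfLe (range_sub_le_ker_add τ hτ)).toEquiv
  rw [h2, ← h1]
  ring

/-- Subgroups of the two eigen-parts: `#X₊ · #X₋ ∣ #A · #H¹(C₂, A)`. [folklore] -/
theorem natCard_mul_natCard_dvd_of_le_ker [Finite A] (hτ : ∀ a, τ (τ a) = a) (Xp Xm : AddSubgroup A)
    (hp : Xp ≤ (τ - AddMonoidHom.id A).ker) (hm : Xm ≤ (τ + AddMonoidHom.id A).ker) :
    Nat.card Xp * Nat.card Xm ∣
      Nat.card A * Nat.card ((τ + AddMonoidHom.id A).ker ⧸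
        ((τ - AddMonoidHom.id A).range).addSubgroupOf (τ + AddMonoidHom.id A).ker) := by
  rw [← natCard_ker_sub_mul_natCard_ker_add τ hτ]
  exact mul_dvd_mul (AddSubgroup.card_dvd_of_le hp) (AddSubgroup.card_dvd_of_le hm)

end Involution

/-! ## §2 Eigen-ladders: the two-sided count over `K` with its defect term -/

section Ladder

variable {A : Type u} [AddCommGroup A]

/-- An independent family of elements of a subgroup `H` is an independent family of `H` (orders and independence transfer
along the injective subtype map). [folklore] -/
theorem exists_indepFamily_subtype {H : AddSubgroup A} {n N : ℕ} (x : Fin n → A) (hmem : ∀ i, x i ∈ H)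
    (hord : ∀ i, addOrderOf (x i) = N) (hind : ∀ c : Fin n → ℤ, ∑ i, c i • x i = 0 → ∀ i, (N : ℤ) ∣ c i) :
    ∃ y : Fin n → H, (∀ i, addOrderOf (y i) = N) ∧ ∀ c : Fin n → ℤ, ∑ i, c i • y i = 0 → ∀ i, (N : ℤ) ∣ c i := by
  refine ⟨fun i ↦ ⟨x i, hmem i⟩, fun i ↦ ?_, fun c hc ↦ hind c ?_⟩
  · rw [← addOrderOf_injective H.subtype H.subtype_injective ⟨x i, hmem i⟩, AddSubgroup.subtype_apply, hord]
  · have h := congrArg H.subtype hc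
    rw [map_sum, map_zero] at h
    simpa only [map_zsmul, AddSubgroup.subtype_apply] using h

/-- **THE TWO-SIDED COUNT OVER `K` (J_K).**  `A` finite abelian with an involution `τ`, `p` prime; if for every `m < T` there are
`2m+2` independent `τ`-fixed elements of order `p^{a(2m)}` and `2m+2` independent `τ`-anti-fixed elements of order `p^{a(2m+1)}`,
then `p^{2 Σ_{j<2T} a j} ∣ #A · #H¹(C₂, A)`.  The factor `#H¹(C₂, A) = #(ker(τ+1)/(τ−1)A)` is exactly what separates this
from the (false) antecedent-free cross-side count `p^{2M₀} ∣ #A`. [cite: McCallumLMS1991, §5 Thm. 5.4]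
[cite: Kramer1981, §4 (13)] -/
theorem pow_two_mul_sum_dvd_natCard_mul_natCard_h1_of_eigenLadders [Finite A] (τ : A →+ A) (hτ : ∀ a, τ (τ a) = a)
    {p : ℕ} (hp : p.Prime) (T : ℕ) (a : ℕ → ℕ)
    (hodd : ∀ m < T, ∃ x : Fin (2 * m + 2) → A, (∀ i, τ (x i) = x i) ∧ (∀ i, addOrderOf (x i) = p ^ a (2 * m)) ∧
      ∀ c : Fin (2 * m + 2) → ℤ, ∑ i, c i • x i = 0 → ∀ i, ((p ^ a (2 * m) : ℕ) : ℤ) ∣ c i)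
    (heven : ∀ m < T, ∃ x : Fin (2 * m + 2) → A, (∀ i, τ (x i) = -x i) ∧ (∀ i, addOrderOf (x i) = p ^ a (2 * m + 1)) ∧
      ∀ c : Fin (2 * m + 2) → ℤ, ∑ i, c i • x i = 0 → ∀ i, ((p ^ a (2 * m + 1) : ℕ) : ℤ) ∣ c i) :
    p ^ (2 * ∑ j ∈ Finset.range (2 * T), a j) ∣
      Nat.card A * Nat.card ((τ + AddMonoidHom.id A).ker ⧸
        ((τ - AddMonoidHom.id A).range).addSubgroupOf (τ + AddMonoidHom.id A).ker) := by
  set Ap : AddSubgroup A := (τ - AddMonoidHom.id A).ker with hAp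
  set Am : AddSubgroup A := (τ + AddMonoidHom.id A).ker with hAm
  have hmemp : ∀ x : A, τ x = x → x ∈ Ap := fun x hx ↦ by
    rw [hAp, AddMonoidHom.mem_ker, AddMonoidHom.sub_apply, AddMonoidHom.id_apply, hx, sub_self]
  have hmemm : ∀ x : A, τ x = -x → x ∈ Am := fun x hx ↦ by
    rw [hAm, AddMonoidHom.mem_ker, AddMonoidHom.add_apply, AddMonoidHom.id_apply, hx, neg_add_cancel]
  have hodd' : ∀ m < T, ∃ x : Fin (2 * m + 2) → Ap, (∀ i, addOrderOf (x i) = p ^ a (2 * m)) ∧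
      ∀ c : Fin (2 * m + 2) → ℤ, ∑ i, c i • x i = 0 → ∀ i, ((p ^ a (2 * m) : ℕ) : ℤ) ∣ c i := fun m hm ↦ by
    obtain ⟨x, hfix, hord, hind⟩ := hodd m hm
    exact exists_indepFamily_subtype x (fun i ↦ hmemp _ (hfix i)) hord hind
  have heven' : ∀ m < T, ∃ x : Fin (2 * m + 2) → Am, (∀ i, addOrderOf (x i) = p ^ a (2 * m + 1)) ∧
      ∀ c : Fin (2 * m + 2) → ℤ, ∑ i, c i • x i = 0 → ∀ i, ((p ^ a (2 * m + 1) : ℕ) : ℤ) ∣ c i := fun m hm ↦ by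
    obtain ⟨x, hfix, hord, hind⟩ := heven m hm
    exact exists_indepFamily_subtype x (fun i ↦ hmemm _ (hfix i)) hord hind
  have h := pow_two_mul_sum_dvd_natCard_mul_of_twinLadder (Ap := Ap) (Am := Am) hp T a hodd' heven'
  rw [natCard_ker_sub_mul_natCard_ker_add τ hτ] at h
  exact h

/-- **Ladder form of J_K.**  With an antitone ladder `M` and `M (2T) = 0`: fixed families of order `p^{M(2m) − M(2m+1)}` and anti-fixed
families of order `p^{M(2m+1) − M(2m+2)}` at every rung `m < T` give `p^{2·M 0} ∣ #A · #H¹(C₂, A)`. [cite: McCallumLMS1991, §5 Thm. 5.4] -/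
theorem pow_two_mul_dvd_natCard_mul_natCard_h1_of_eigenLadders [Finite A] (τ : A →+ A) (hτ : ∀ a, τ (τ a) = a)
    {p : ℕ} (hp : p.Prime) (T : ℕ) (M : ℕ → ℕ) (hM : ∀ j, M (j + 1) ≤ M j) (hMT : M (2 * T) = 0)
    (hodd : ∀ m < T, ∃ x : Fin (2 * m + 2) → A, (∀ i, τ (x i) = x i) ∧
      (∀ i, addOrderOf (x i) = p ^ (M (2 * m) - M (2 * m + 1))) ∧
      ∀ c : Fin (2 * m + 2) → ℤ, ∑ i, c i • x i = 0 → ∀ i, ((p ^ (M (2 * m) - M (2 * m + 1)) : ℕ) : ℤ) ∣ c i)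
    (heven : ∀ m < T, ∃ x : Fin (2 * m + 2) → A, (∀ i, τ (x i) = -x i) ∧
      (∀ i, addOrderOf (x i) = p ^ (M (2 * m + 1) - M (2 * m + 2))) ∧
      ∀ c : Fin (2 * m + 2) → ℤ, ∑ i, c i • x i = 0 → ∀ i, ((p ^ (M (2 * m + 1) - M (2 * m + 2)) : ℕ) : ℤ) ∣ c i) :
    p ^ (2 * M 0) ∣
      Nat.card A * Nat.card ((τ + AddMonoidHom.id A).ker ⧸
        ((τ - AddMonoidHom.id A).range).addSubgroupOf (τ + AddMonoidHom.id A).ker) := by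
  have h := pow_two_mul_sum_dvd_natCard_mul_natCard_h1_of_eigenLadders τ hτ hp T (fun j ↦ M j - M (j + 1))
    (fun m hm ↦ hodd m hm) (fun m hm ↦ by
      obtain ⟨x, hfix, hord, hind⟩ := heven m hm
      exact ⟨x, hfix, fun i ↦ by rw [hord i], fun c hc i ↦ by simpa using hind c hc i⟩)
  rwa [sum_range_sub_eq_of_antitone M hM, hMT, Nat.sub_zero] at h

end Ladder

end Summit.BirchSwinnertonDyer.BirchSwinnertonDyer.Theorems.GenusExact.PlusDescent
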